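import Summits.QuantumFields.YangMills.Theorems.ThermalDescentMaxwellRungImages

/-!
# `ThermalDescent` / `ZeroTemperatureFloors` BC5 rung — file 4/6: the separation window, uniform image bounds for periods
# `T ≥ 3ℓ`, and the IMAGE EXPANSION `tr H_T(z)² = Σ_{(n,m)} tr h(z_n)h(z_m) ≥ 48/|z|⁸` with every cross term non-negative

Tribunal-w seat `ym-td-bc5w-1` (planner, gen 2).  The six files `ThermalDescentMaxwellRung{Defs,Kernel,Images,Window,
Chain,Floors}` are the ≤ 400-line Theorems split of the crux workfile
`Cruxes/ZeroTemperatureFloors/Lines/rung_maxwell.lean` (commit 53ced2b6fc84): the thermal free Maxwell₄ field as a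
DECIDED SEPARATING MODEL for the deciding crux `ZeroTemperatureFloors` (stmt-QuantumFields-25390) of route
`ThermalDescent` — statement, dictionary and mechanism in `…Floors`.  Helper files (`--supports` the crux), close nothing;
route-independent (imports `Mathlib`, the Mathlib-only certificate `TreeLevelSkewnessVanishes`, `Literature…EuclideanAction`).

On `W_ℓ = {3ℓ/4 ≤ z₀ ≤ 5ℓ/4, 16|z⃗|² ≤ ℓ²}` and for every period `T ≥ 3ℓ`: all images satisfy `(z₀+nT)² ≥ (9ℓ²/16)(n²+1)`
(`time_img_sq_ge`) and lie in the double cone (`cone_img`), so every cross-image trace is `≥ 0` (`cross_nonneg`); the entries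
are dominated by `C_ℓ (n²+1)⁻²` (`abs_entry_img_le`, `abs_thermalHess_le`); and the Cauchy product of the absolutely convergent
image sums (`tsum_mul_tsum_of_summable_norm`) exhibits `tr H_T²` as a non-negative double series whose `(0,0)` term is the
vacuum value (`trace_thermalHess_sq_ge`) — the thermal density dominates the vacuum density TERMWISE, no limit taken.  Hence
`k_min(ℓ) ≤ k_T ≤ k_max(ℓ)` on the window, uniformly in `T ≥ 3ℓ` (`kT_lower`, `kT_upper`).

NOTHING HERE PROVES `ZeroTemperatureFloors`, `NT`, or the Yang–Mills mass gap: free-field Gaussian analysis on `ℝ⁴`,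
a witness (R3/RECORD framing) that the deciding crux has content of its own outside NT's printed regime.
[cite: OsterwalderSeilerAnnPhys1978, §2–3; Luscher1977; GlimmJaffe1987, §6.3, §7]
-/

set_option autoImplicit false

open scoped SchwartzMap BigOperators Topology
open MeasureTheory Filter Topology Matrix Metric Set
open Literature.MathematicalPhysics.QuantumLattice

noncomputable section

namespace Summit.QuantumFields.YangMills.Theorems.ThermalDescent.MaxwellRung
open Summit.QuantumFields.YangMills.Theorems.SelfNormalisedSkewness.Negative

/-! ### The separation window `W_ℓ` and uniform image bounds for periods `T ≥ 3ℓ` -/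

/-- **All images stay in the time cone, quantitatively**: for `z ∈ W_ℓ`, `T ≥ 3ℓ` and every `n ∈ ℤ`,
`(z₀ + nT)² ≥ (9ℓ²/16)(n² + 1)`. [this route] -/
theorem time_img_sq_ge {ℓ T : ℝ} (hℓ : 0 < ℓ) (hT : 3 * ℓ ≤ T) {z : E4} (hz : z ∈ W ℓ) (n : ℤ) :
    9 * ℓ ^ 2 / 16 * ((n : ℝ) ^ 2 + 1) ≤ (z 0 + n * T) ^ 2 := by
  obtain ⟨hz1, hz2, -⟩ := hz
  rcases lt_trichotomy n 0 with hn | rfl | hn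
  · have hn' : (n : ℝ) ≤ -1 := by exact_mod_cast (show n ≤ -1 by omega)
    have h1 : (n : ℝ) * T ≤ 3 * ℓ * n := by nlinarith
    have h2 : z 0 + n * T ≤ 5 * ℓ / 4 + 3 * ℓ * n := by linarith
    have h3 : 5 * ℓ / 4 + 3 * ℓ * n ≤ 0 := by nlinarith
    have h4 : (5 * ℓ / 4 + 3 * ℓ * n) ^ 2 ≤ (z 0 + n * T) ^ 2 := by nlinarith
    have h5 : 0 ≤ (-(n : ℝ) - 1) * (-(n : ℝ)) := mul_nonneg (by linarith) (by linarith)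
    have h6 : (5 * ℓ / 4 + 3 * ℓ * n) ^ 2 - 9 * ℓ ^ 2 / 16 * ((n : ℝ) ^ 2 + 1) =
        ℓ ^ 2 * (135 / 16 * ((-(n : ℝ) - 1) * (-(n : ℝ))) + 15 / 16 * (-(n : ℝ)) + 1) := by ring
    have h7 : 0 ≤ ℓ ^ 2 * (135 / 16 * ((-(n : ℝ) - 1) * (-(n : ℝ))) + 15 / 16 * (-(n : ℝ)) + 1) :=
      mul_nonneg (sq_nonneg ℓ) (by nlinarith)
    linarith
  · simp only [Int.cast_zero, zero_mul, add_zero]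
    nlinarith
  · have hn' : (1 : ℝ) ≤ n := by exact_mod_cast (show 1 ≤ n by omega)
    have h1 : 3 * ℓ * n ≤ (n : ℝ) * T := by nlinarith
    have h2 : 3 * ℓ * n ≤ z 0 + n * T := by linarith
    have h3 : 0 ≤ 3 * ℓ * n := by positivity
    have h4 : (3 * ℓ * n) ^ 2 ≤ (z 0 + n * T) ^ 2 := pow_le_pow_left₀ h3 h2 2
    have h5 : 0 ≤ ℓ ^ 2 * ((n : ℝ) ^ 2 - 1) := mul_nonneg (sq_nonneg ℓ) (by nlinarith)
    nlinarith [sq_nonneg ℓ]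

/-- All images are uniformly far from the origin on the window: `|z_n|² ≥ (9ℓ²/16)(n²+1)`. [this route] -/
theorem nsq_img_ge {ℓ T : ℝ} (hℓ : 0 < ℓ) (hT : 3 * ℓ ≤ T) {z : E4} (hz : z ∈ W ℓ) (n : ℤ) :
    9 * ℓ ^ 2 / 16 * ((n : ℝ) ^ 2 + 1) ≤ nsq (img T n z) := by
  rw [nsq_img]
  linarith [time_img_sq_ge hℓ hT hz n, spSq_nonneg z]

/-- All images of a window separation lie in the double cone `4|a⃗|² ≤ a₀²` (`T ≥ 3ℓ`). [this route] -/
theorem cone_img {ℓ T : ℝ} (hℓ : 0 < ℓ) (hT : 3 * ℓ ≤ T) {z : E4} (hz : z ∈ W ℓ) (n : ℤ) :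
    4 * spSq (img T n z) ≤ (img T n z) 0 ^ 2 := by
  rw [spSq_img, img_apply_zero]
  have h1 := time_img_sq_ge hℓ hT hz n
  have h2 : 9 * ℓ ^ 2 / 16 ≤ 9 * ℓ ^ 2 / 16 * ((n : ℝ) ^ 2 + 1) :=
    le_mul_of_one_le_right (by positivity) (by nlinarith)
  have h3 : 16 * spSq z ≤ ℓ ^ 2 := hz.2.2
  nlinarith [sq_nonneg ℓ]

/-- **Every cross-image term is non-negative on the window**: `tr (∂∂|z_n|⁻²)(∂∂|z_m|⁻²) ≥ 0` for all
`n, m ∈ ℤ` (`z ∈ W_ℓ`, `T ≥ 3ℓ`) — all images lie in the `60°` double cone about the time axis.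
[this route] -/
theorem cross_nonneg {ℓ T : ℝ} (hℓ : 0 < ℓ) (hT : 3 * ℓ ≤ T) {z : E4} (hz : z ∈ W ℓ) (n m : ℤ) :
    0 ≤ (hessInvSq (img T n z) * hessInvSq (img T m z)).trace :=
  trace_hessInvSq_mul_nonneg (cone_criterion (cone_img hℓ hT hz n) (cone_img hℓ hT hz m))

/-- `0 ≤ C_ℓ`. [this route] -/
theorem Cb_nonneg (ℓ : ℝ) : 0 ≤ Cb ℓ := by unfold Cb; positivity

/-- Uniform entry bound on the window: `|(∂∂|z_n|⁻²)_{μρ}| ≤ C_ℓ/(n² + 1)²`. [this route] -/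
theorem abs_entry_img_le {ℓ T : ℝ} (hℓ : 0 < ℓ) (hT : 3 * ℓ ≤ T) {z : E4} (hz : z ∈ W ℓ) (n : ℤ)
    (μ ρ : Fin 4) : |hessInvSq (img T n z) μ ρ| ≤ Cb ℓ * (1 / ((n : ℝ) ^ 2 + 1) ^ 2) := by
  have hq : 0 < 9 * ℓ ^ 2 / 16 * ((n : ℝ) ^ 2 + 1) := by positivity
  have hge := nsq_img_ge hℓ hT hz n
  have hℓ0 : ℓ ≠ 0 := hℓ.ne'
  calc |hessInvSq (img T n z) μ ρ| ≤ 10 / nsq (img T n z) ^ 2 := abs_hessInvSq_le _ μ ρ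
    _ ≤ 10 / (9 * ℓ ^ 2 / 16 * ((n : ℝ) ^ 2 + 1)) ^ 2 :=
        div_le_div_of_nonneg_left (by norm_num) (by positivity) (pow_le_pow_left₀ hq.le hge 2)
    _ = Cb ℓ * (1 / ((n : ℝ) ^ 2 + 1) ^ 2) := by
        unfold Cb
        field_simp

/-- `Σ_{n∈ℤ} (n²+1)⁻²` converges. [folklore] -/
theorem summable_invSq : Summable fun n : ℤ => 1 / ((n : ℝ) ^ 2 + 1) ^ 2 := by
  have hnat : Summable fun n : ℕ => 1 / ((n : ℝ) ^ 2 + 1) ^ 2 := by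
    have hf : Summable fun n : ℕ => 4 * (1 / (n : ℝ) ^ 4) :=
      (Real.summable_one_div_nat_pow.mpr (by norm_num)).mul_left 4
    have h4 : Summable fun n : ℕ => 4 * (1 / ((n + 1 : ℕ) : ℝ) ^ 4) :=
      (summable_nat_add_iff (f := fun n : ℕ => 4 * (1 / (n : ℝ) ^ 4)) 1).mpr hf
    refine Summable.of_nonneg_of_le (fun n => by positivity) (fun n => ?_) h4
    have hn : (0 : ℝ) ≤ n := n.cast_nonneg
    have hkey : 0 ≤ ((n : ℝ) - 1) ^ 2 * (3 * (n : ℝ) ^ 2 + 2 * n + 3) :=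
      mul_nonneg (sq_nonneg _) (by positivity)
    rw [Nat.cast_succ, div_le_iff₀ (by positivity)]
    rw [show 4 * (1 / ((n : ℝ) + 1) ^ 4) * (((n : ℝ)) ^ 2 + 1) ^ 2 =
      4 * ((n : ℝ) ^ 2 + 1) ^ 2 / ((n : ℝ) + 1) ^ 4 by ring, le_div_iff₀ (by positivity)]
    nlinarith
  refine Summable.of_nat_of_neg ?_ ?_
  · simpa using hnat
  · simpa using hnat

/-- `0 ≤ S`. [folklore] -/
theorem Sζ_nonneg : 0 ≤ Sζ := tsum_nonneg fun n => by positivity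

/-- On the window the image entry families are absolutely summable, dominated by `C_ℓ (n²+1)⁻²`. [this route] -/
theorem summable_norm_entry_img {ℓ T : ℝ} (hℓ : 0 < ℓ) (hT : 3 * ℓ ≤ T) {z : E4} (hz : z ∈ W ℓ)
    (μ ρ : Fin 4) : Summable fun n : ℤ => ‖hessInvSq (img T n z) μ ρ‖ :=
  Summable.of_nonneg_of_le (fun _ => norm_nonneg _)
    (fun n => by rw [Real.norm_eq_abs]; exact abs_entry_img_le hℓ hT hz n μ ρ)
    (summable_invSq.mul_left (Cb ℓ))

/-- **Uniform bound on the periodised Hessian on the window**: `|H_T(z)_{μρ}| ≤ C_ℓ·S`, for every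
period `T ≥ 3ℓ`. [this route] -/
theorem abs_thermalHess_le {ℓ T : ℝ} (hℓ : 0 < ℓ) (hT : 3 * ℓ ≤ T) {z : E4} (hz : z ∈ W ℓ)
    (μ ρ : Fin 4) : |thermalHess T z μ ρ| ≤ Cb ℓ * Sζ := by
  have hg : HasSum (fun n : ℤ => Cb ℓ * (1 / ((n : ℝ) ^ 2 + 1) ^ 2)) (Cb ℓ * Sζ) :=
    summable_invSq.hasSum.mul_left (Cb ℓ)
  have := tsum_of_norm_bounded hg
    (fun n => by rw [Real.norm_eq_abs]; exact abs_entry_img_le hℓ hT hz n μ ρ)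
  rwa [Real.norm_eq_abs] at this

/-- **The image expansion and its positivity**: on the window, for `T ≥ 3ℓ`,
`tr H_T(z)² = Σ_{(n,m)∈ℤ²} tr (∂∂|z_n|⁻²)(∂∂|z_m|⁻²) ≥ tr (∂∂|z|⁻²)² = 48/|z|⁸` — every cross
term being non-negative (`cross_nonneg`), the thermal density dominates the vacuum one TERMWISE,
with no limit taken. [this route] -/
theorem trace_thermalHess_sq_ge {ℓ T : ℝ} (hℓ : 0 < ℓ) (hT : 3 * ℓ ≤ T) {z : E4} (hz : z ∈ W ℓ) :
    48 / nsq z ^ 4 ≤ (thermalHess T z * thermalHess T z).trace := by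
  have hsn : ∀ μ ρ : Fin 4, Summable fun n : ℤ => ‖hessInvSq (img T n z) μ ρ‖ :=
    fun μ ρ => summable_norm_entry_img hℓ hT hz μ ρ
  have hprod : ∀ μ ρ : Fin 4, Summable fun p : ℤ × ℤ =>
      hessInvSq (img T p.1 z) μ ρ * hessInvSq (img T p.2 z) ρ μ :=
    fun μ ρ => summable_mul_of_summable_norm (f := fun n : ℤ => hessInvSq (img T n z) μ ρ)
      (g := fun n : ℤ => hessInvSq (img T n z) ρ μ) (hsn μ ρ) (hsn ρ μ)
  have h1 : (thermalHess T z * thermalHess T z).trace =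
      ∑ μ, ∑ ρ, (∑' n : ℤ, hessInvSq (img T n z) μ ρ) * (∑' m : ℤ, hessInvSq (img T m z) ρ μ) :=
    trace_sq_eq_sum _
  have h2 : ∀ μ ρ : Fin 4,
      (∑' n : ℤ, hessInvSq (img T n z) μ ρ) * (∑' m : ℤ, hessInvSq (img T m z) ρ μ) =
        ∑' p : ℤ × ℤ, hessInvSq (img T p.1 z) μ ρ * hessInvSq (img T p.2 z) ρ μ :=
    fun μ ρ => tsum_mul_tsum_of_summable_norm (hsn μ ρ) (hsn ρ μ)
  have h3 : ∀ μ : Fin 4,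
      ∑ ρ, ∑' p : ℤ × ℤ, hessInvSq (img T p.1 z) μ ρ * hessInvSq (img T p.2 z) ρ μ =
        ∑' p : ℤ × ℤ, ∑ ρ, hessInvSq (img T p.1 z) μ ρ * hessInvSq (img T p.2 z) ρ μ :=
    fun μ => (Summable.tsum_finsetSum fun ρ _ => hprod μ ρ).symm
  have h4 : ∑ μ, ∑' p : ℤ × ℤ, ∑ ρ, hessInvSq (img T p.1 z) μ ρ * hessInvSq (img T p.2 z) ρ μ =
      ∑' p : ℤ × ℤ, ∑ μ, ∑ ρ, hessInvSq (img T p.1 z) μ ρ * hessInvSq (img T p.2 z) ρ μ :=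
    (Summable.tsum_finsetSum fun μ _ => summable_sum fun ρ _ => hprod μ ρ).symm
  have h5 : ∀ p : ℤ × ℤ, ∑ μ, ∑ ρ, hessInvSq (img T p.1 z) μ ρ * hessInvSq (img T p.2 z) ρ μ =
      (hessInvSq (img T p.1 z) * hessInvSq (img T p.2 z)).trace :=
    fun p => by simp [Matrix.trace, Matrix.mul_apply]
  have hexp : (thermalHess T z * thermalHess T z).trace =
      ∑' p : ℤ × ℤ, (hessInvSq (img T p.1 z) * hessInvSq (img T p.2 z)).trace := by
    rw [h1]
    simp_rw [h2, h3]
    rw [h4]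
    exact tsum_congr h5
  have hsumm : Summable fun p : ℤ × ℤ =>
      (hessInvSq (img T p.1 z) * hessInvSq (img T p.2 z)).trace :=
    (summable_sum (s := Finset.univ) fun μ (_ : μ ∈ Finset.univ) =>
      summable_sum (s := Finset.univ) fun ρ (_ : ρ ∈ Finset.univ) => hprod μ ρ).congr h5
  have hnn : ∀ p : ℤ × ℤ, 0 ≤ (hessInvSq (img T p.1 z) * hessInvSq (img T p.2 z)).trace :=
    fun p => cross_nonneg hℓ hT hz p.1 p.2
  calc 48 / nsq z ^ 4 = (hessInvSq (img T 0 z) * hessInvSq (img T 0 z)).trace := by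
        rw [img_zero, trace_hessInvSq_sq]
    _ ≤ ∑' p : ℤ × ℤ, (hessInvSq (img T p.1 z) * hessInvSq (img T p.2 z)).trace :=
        hsumm.le_tsum (0, 0) fun p _ => hnn p
    _ = (thermalHess T z * thermalHess T z).trace := hexp.symm

/-! ### Two-sided bounds of `k_T` on the window, uniform in the period `T ≥ 3ℓ` -/

/-- Window separations are non-zero. [this route] -/
theorem nsq_pos_of_mem_W {ℓ : ℝ} (hℓ : 0 < ℓ) {z : E4} (hz : z ∈ W ℓ) : 0 < nsq z := by
  have h := time_sq_le_nsq z
  have h0 : 0 < z 0 := by linarith [hz.1]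
  nlinarith

/-- Window separations have `|z|² ≤ 13ℓ²/8`. [this route] -/
theorem nsq_le_of_mem_W {ℓ : ℝ} {z : E4} (hz : z ∈ W ℓ) : nsq z ≤ 13 * ℓ ^ 2 / 8 := by
  rw [nsq_eq_time_add_spSq]
  obtain ⟨h1, h2, h3⟩ := hz
  nlinarith

/-- `0 < k_min(ℓ)`. [this route] -/
theorem kmin_pos {ℓ : ℝ} (hℓ : 0 < ℓ) : 0 < kmin ℓ := by unfold kmin; positivity

/-- **Thermal ≥ vacuum ≥ floor on the window, for every period `T ≥ 3ℓ`**: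
`k_T(z) ≥ 96/|z|⁸ ≥ k_min(ℓ)`. [this route] -/
theorem kT_lower {ℓ T : ℝ} (hℓ : 0 < ℓ) (hT : 3 * ℓ ≤ T) {z : E4} (hz : z ∈ W ℓ) :
    kmin ℓ ≤ kT T z := by
  have h1 := trace_thermalHess_sq_ge hℓ hT hz
  have h2 : kmin ℓ ≤ 96 / nsq z ^ 4 := by
    unfold kmin
    exact div_le_div_of_nonneg_left (by norm_num) (pow_pos (nsq_pos_of_mem_W hℓ hz) 4)
      (pow_le_pow_left₀ (nsq_nonneg z) (nsq_le_of_mem_W hz) 4)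
  have h3 : 96 / nsq z ^ 4 ≤ 2 * (thermalHess T z * thermalHess T z).trace := by
    have h96 : 96 / nsq z ^ 4 = 2 * (48 / nsq z ^ 4) := by ring
    rw [h96]
    exact mul_le_mul_of_nonneg_left h1 (by norm_num)
  rw [kT_eq]
  nlinarith [sq_nonneg (thermalHess T z).trace]

/-- The uniform ceiling: `k_T(z) ≤ k_max(ℓ)` on the window, every `T ≥ 3ℓ`. [this route] -/
theorem kT_upper {ℓ T : ℝ} (hℓ : 0 < ℓ) (hT : 3 * ℓ ≤ T) {z : E4} (hz : z ∈ W ℓ) :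
    kT T z ≤ kmax ℓ := by
  have hT0 : 0 < T := by linarith
  have hB : ∀ μ ρ : Fin 4, |thermalHess T z μ ρ| ≤ Cb ℓ * Sζ :=
    fun μ ρ => abs_thermalHess_le hℓ hT hz μ ρ
  have hB0 : 0 ≤ Cb ℓ * Sζ := mul_nonneg (Cb_nonneg ℓ) Sζ_nonneg
  have hterm : ∀ μ ρ : Fin 4,
      thermalHess T z μ ρ * thermalHess T z ρ μ ≤ (Cb ℓ * Sζ) * (Cb ℓ * Sζ) := fun μ ρ =>
    (le_abs_self _).trans (by
      rw [abs_mul]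
      exact mul_le_mul (hB μ ρ) (hB ρ μ) (abs_nonneg _) hB0)
  rw [kT_eq, thermalHess_trace hT0, trace_sq_eq_sum]
  have hsum : ∑ μ : Fin 4, ∑ ρ : Fin 4, thermalHess T z μ ρ * thermalHess T z ρ μ ≤
      ∑ _μ : Fin 4, ∑ _ρ : Fin 4, (Cb ℓ * Sζ) * (Cb ℓ * Sζ) :=
    Finset.sum_le_sum fun μ _ => Finset.sum_le_sum fun ρ _ => hterm μ ρ
  have hconst : ∑ _μ : Fin 4, ∑ _ρ : Fin 4, (Cb ℓ * Sζ) * (Cb ℓ * Sζ) = 16 * (Cb ℓ * Sζ) ^ 2 := by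
    simp only [Finset.sum_const, Finset.card_univ, Fintype.card_fin]
    ring
  unfold kmax
  nlinarith

end Summit.QuantumFields.YangMills.Theorems.ThermalDescent.MaxwellRung

end
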